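import Literature.MathematicalPhysics.QuantumFieldTheory.Balaban1983to89.B3Eq15JointSmooth
import Literature.Analysis.Calculus.MixedPartialDerivWithin

/-!
# `Balaban1983to89.B3Eq15MixedPartials` — T. Bałaban, *(Higgs)₂,₃ quantum fields in a finite volume. III.
Renormalization*, Commun. Math. Phys. **88** (1983) 411–445 [Balaban1983Higgs3], (1.5) p. 412 [PDF 2]:
**the coefficients of the repaired perturbative sum (1.5) ARE the printed mixed partials
`∂^{α+β}E_k/∂e′^α∂λ′^β |_{e′=λ′=0}` of the jointly smooth `E_k`, read as ONE joint derivative** — for the typed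
`E_k` of (1.4) (`B3Eq14AuxFunction.Data14.auxE`), jointly `C^∞` in `(e′, λ′)` on `ℝ × [0, δ]`
(`B3Eq15JointSmooth.contDiffOn_auxE_joint_infty`), every iterated slice derivative
`∂^α_{e′}[∂^β_{λ′,+}E_k(e′, ·)(0)](e₀)` entering `B3Eq15OneSidedInteraction.interaction15R` equals the entry
`D^{α+β}_{ℝ×[0,δ]}E_k(e₀, 0)((1,0)^α, (0,1)^β)` of the `(α+β)`-th Fréchet derivative WITHIN `ℝ × [0, δ]`, the order
of the two differentiations is immaterial (Schwarz within the slab, endpoint `λ′ = 0` included), and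
`interaction15R = Σ_{1≤α+β≤n̄} (α!β!)⁻¹ D^{α+β}_{ℝ×[0,δ]}E_k(0, 0)((1,0)^α, (0,1)^β)` — (1.5) is the double Taylor
polynomial (constant term removed) of the two-variable function `E_k` at `(0, 0⁺)`; in the words of part I (p. 624
[PDF 22], after (I.3.62), render paper I p022): *"Because we take here an expansion until the order n̄ only, so in
(3.61) we can take a whole function E_k instead of its expansion until the order n̄"* … *"instead of the Taylor
expansion of the function E_k in the exponent we have the function E_k(…) itself"* [Balaban1982Higgs1].  (v1.1,
docstring-only: v1 put the paraphrase «expand … with respect to e′, λ′ up to order n̄» in quotation marks; it is not a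
sentence of III p. 412 — corrected.)

statement-level skeleton of published theorems with citation tags; proofs where landed; nothing here is a claim about
the Yang–Mills mass gap

THE ARGUMENT (ours; calculus).  `Literature.Analysis.Calculus.MixedPartialDerivWithin` (Coleman, *Calculus on Normed
Vector Spaces* §4.5: `∂^k f/∂x_{i₁}⋯∂x_{i_k}(a) = f^{(k)}(a)(e_{i₁}, …, e_{i_k})`, in the within-`univ ×ˢ I` form; §4.1
Thm. 4.3 / §4.4 Cor. 4.3: symmetry) applied to `Φ(e′, λ′) = E_k(e′, λ′, Ω, A^{(k)}, φ)` on `I = [0, δ]`, after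
replacing the derivative within `[0, ∞)` at `0` by the one within `[0, δ]`
(`B3Eq14LamAllOrders.iteratedDerivWithin_auxE_Ici_eq_Icc`).

WHAT IS PROVED (theorems only; no definition, no `Prop` fact; axioms standard).  Hypotheses (H-joint) of
`B3Eq15JointSmooth`: `μ₀² > 0`, `a > 0`, `L > 1`, `1 ≤ k ≤ K`, `L^kε ≠ 0`, `λ(L^kε) ≥ 0`, `m² > 0`, `δ > 0`,
`m² + δm²(e′, λ′, x) > 0` for all `e′`, `λ′ ∈ [0, δ]`, `x ∈ Ω₁`, data `δm²(·, ·, x)`, `E₁` jointly `C^∞`: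
* **`iteratedDeriv_slice_auxE_eq_iteratedFDerivWithin`** — `∂^α_{e′}[∂^β_{λ′,[0,∞)}E_k(e′,·)(0)](e₀)
  = D^{α+β}_{ℝ×[0,δ]}E_k(e₀, 0)((1,0)^α, (0,1)^β)` for all `α, β, e₀`;
* **`iteratedDerivWithin_slice_auxE_eq_iteratedFDerivWithin`** — the other order,
  `∂^β_{λ′,[0,∞)}[∂^α_{e′}E_k(·, λ′)(e₀)](0) = D^{β+α}_{ℝ×[0,δ]}E_k(e₀, 0)((0,1)^β, (1,0)^α)`;
* **`iteratedFDerivWithin_auxE_comp_perm`** — `D^m_{ℝ×[0,δ]}E_k(e₀, t)` is a SYMMETRIC `m`-linear map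
  (`t ∈ [0, δ]`, every `m`);
* **`iteratedDeriv_iteratedDerivWithin_auxE_comm`** — `∂^α_{e′}∂^β_{λ′,+}E_k(e₀, 0) = ∂^β_{λ′,+}∂^α_{e′}E_k(e₀, 0)`
  (both within `[0, ∞)` at `0`);
* **`interaction15R_eq_sum_iteratedFDerivWithin`** — the repaired (1.5) as the sum of joint Taylor coefficients.
HONEST SCOPE: identities between derivatives of the typed `E_k` only — no value of any coefficient (orders `≤ 2`:
`B3Eq15ChargeDerivative`, `B3Eq15ChargeSecondOrder`), nothing about the bounds (1.7); the regularity is that of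
the SUPPLIED data `Data14.dm2`, `Data14.E1`.

PDF held: `paper:balaban1983-higgs-2-3-quantum-fields-finite-volume` (journal page = PDF page + 410); (1.5) p. 412
[PDF 2] read from the render `run/shared/lean/pub/pub-balaban/b2b-balaban-ref1/pages/` (paper III p002).

CITATION HEADER (lean-in-tree rule).  lit-balaban TYPED SKELETON (HOME `run/shared/lean/pub/lit-balaban/`), rows
**B3.Eq1.4** / **B3.Eq1.5** (owner r15; decls of record `B3Eq14AuxFunction.Data14.auxE`,
`B3Eq15OneSidedInteraction.interaction15R`); unit `lit-balaban-typer` (literature-prover-lit-balaban-typer-g28-0).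
Nothing of any other seat is touched; no row changes head.  PDF of part I held: `paper:balaban1982-cmp85-higgs23-i`
(journal page = PDF page + 602).
-/

open _root_.MeasureTheory

namespace Literature.MathematicalPhysics.QuantumFieldTheory.Balaban1983to89.B3Eq15MixedPartials

open Literature.MathematicalPhysics.QuantumFieldTheory.Balaban1983to89.HiggsLattice
open Literature.MathematicalPhysics.QuantumFieldTheory.Balaban1983to89.B3Eq14AuxFunction
open Literature.MathematicalPhysics.QuantumFieldTheory.Balaban1983to89.B3Eq15OneSidedInteraction
open Literature.MathematicalPhysics.QuantumFieldTheory.Balaban1983to89.B3Eq14LamAllOrders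
  (iteratedDerivWithin_auxE_Ici_eq_Icc)
open Literature.MathematicalPhysics.QuantumFieldTheory.Balaban1983to89.B3Eq15JointSmooth
  (contDiffOn_auxE_joint_infty)
open Literature.Analysis.Calculus
  (iteratedDeriv_iteratedDerivWithin_slice_eq_append iteratedDerivWithin_iteratedDeriv_slice_eq_append
    iteratedFDerivWithin_comp_perm_of_mem_closure_interior iteratedDeriv_iteratedDerivWithin_comm)
open Set Filter Topology
open scoped BigOperators ContDiff

noncomputable section

variable {P : HiggsLattice.Params} {N : ℕ} {k : ℕ} (D : Data14 P N k)

/-- Near every `u < δ` the sets `[0, ∞)` and `[0, δ]` coincide, so iterated derivatives within them agree at `u`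
(any function). [folklore] -/
private theorem iteratedDerivWithin_Ici_eq_Icc' {f : ℝ → ℝ} {δ u : ℝ} (hu : u < δ) (n : ℕ) :
    iteratedDerivWithin n f (Set.Ici 0) u = iteratedDerivWithin n f (Set.Icc 0 δ) u := by
  have h : Set.Ici (0 : ℝ) =ᶠ[𝓝 u] Set.Icc 0 δ := by
    filter_upwards [Iio_mem_nhds hu] with x hx
    simp only [eq_iff_iff]
    exact ⟨fun h => ⟨h, (Set.mem_Iio.1 hx).le⟩, fun h => h.1⟩
  rw [iteratedDerivWithin_eq_iteratedFDerivWithin, iteratedDerivWithin_eq_iteratedFDerivWithin,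
    iteratedFDerivWithin_congr_set h]

/-- `(e₀, 0)` lies in the closure of the interior of the slab `ℝ × [0, δ]` (`δ > 0`). [folklore] -/
private theorem zero_mem_closure_interior_Icc {δ : ℝ} (hδ : 0 < δ) :
    (0 : ℝ) ∈ closure (interior (Set.Icc (0 : ℝ) δ)) := by
  rw [interior_Icc, closure_Ioo hδ.ne]
  exact ⟨le_rfl, hδ.le⟩

/-- **`∂^α_{e′}[∂^β_{λ′,+}E_k(e′, ·)|_{λ′=0}](e₀) = D^{α+β}_{ℝ×[0,δ]}E_k(e₀, 0)((1,0), …, (1,0), (0,1), …, (0,1))`**: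
every iterated slice derivative of the typed `E_k` entering the repaired (1.5) (`λ′`-derivative within `[0, ∞)`
at `0`, then `e′`-derivatives) is the printed mixed partial `∂^{α+β}E_k/∂e′^α∂λ′^β(e₀, 0⁺)` read as the entry of
the joint `(α+β)`-th Fréchet derivative within the slab on `α` copies of `(1,0)` and `β` copies of `(0,1)`
(H-joint, `δ > 0`, `C^∞` data; all `α, β`). [cite: Balaban1983Higgs3, (1.5) p.412] -/
theorem iteratedDeriv_slice_auxE_eq_iteratedFDerivWithin (hmsq : 0 < D.msq) (ha : 0 < D.a) (hL : 1 < (P.L : ℝ))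
    (hk1 : 1 ≤ k) (hk : k ≤ P.K) (hℓ : D.ell ≠ 0) (hrun : 0 ≤ D.lamRun) (hm2 : 0 < D.m2) {δ : ℝ} (hδ : 0 < δ)
    (hmass : ∀ (e' s : ℝ), s ∈ Set.Icc (0 : ℝ) δ → ∀ x ∈ D.Ω₁, 0 < D.m2 + D.dm2 e' s x)
    (hdm2 : ∀ x ∈ D.Ω₁, ContDiff ℝ ∞ (fun p : ℝ × ℝ => D.dm2 p.1 p.2 x))
    (hE1 : ContDiff ℝ ∞ (fun p : ℝ × ℝ => D.E1 p.1 p.2)) (Ak : HiggsLattice.VecField P 0)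
    (φ : HiggsLattice.ScalarField P k N) (α β : ℕ) (e₀ : ℝ) :
    iteratedDeriv α (fun e' => iteratedDerivWithin β (fun l' => D.auxE e' l' Ak φ) (Set.Ici 0) 0) e₀
      = iteratedFDerivWithin ℝ (α + β) (fun p : ℝ × ℝ => D.auxE p.1 p.2 Ak φ) (Set.univ ×ˢ Set.Icc 0 δ) (e₀, 0)
          (Fin.append (fun _ => ((1 : ℝ), (0 : ℝ))) (fun _ => ((0 : ℝ), (1 : ℝ)))) := by
  have hE := contDiffOn_auxE_joint_infty D hmsq ha hL hk1 hk hℓ hrun hm2 hmass hdm2 hE1 Ak φ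
  have e : (fun e' => iteratedDerivWithin β (fun l' => D.auxE e' l' Ak φ) (Set.Ici 0) 0)
      = fun e' => iteratedDerivWithin β (fun s => (fun p : ℝ × ℝ => D.auxE p.1 p.2 Ak φ) (e', s))
          (Set.Icc 0 δ) 0 := by
    funext e'
    exact iteratedDerivWithin_auxE_Ici_eq_Icc D hδ e' Ak φ β
  rw [e]
  exact iteratedDeriv_iteratedDerivWithin_slice_eq_append hE (uniqueDiffOn_Icc hδ) (mod_cast le_top) e₀
    ⟨le_rfl, hδ.le⟩

/-- **The other order: `∂^β_{λ′,+}[∂^α_{e′}E_k(·, λ′)(e₀)]|_{λ′=0} = D^{β+α}_{ℝ×[0,δ]}E_k(e₀, 0)((0,1), …, (0,1), (1,0), …, (1,0))`**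
(`λ′`-derivative within `[0, ∞)` at `0` of the `e′`-derivatives; H-joint, `δ > 0`, `C^∞` data; all `α, β`).
[cite: Balaban1983Higgs3, (1.5) p.412] -/
theorem iteratedDerivWithin_slice_auxE_eq_iteratedFDerivWithin (hmsq : 0 < D.msq) (ha : 0 < D.a)
    (hL : 1 < (P.L : ℝ)) (hk1 : 1 ≤ k) (hk : k ≤ P.K) (hℓ : D.ell ≠ 0) (hrun : 0 ≤ D.lamRun) (hm2 : 0 < D.m2)
    {δ : ℝ} (hδ : 0 < δ) (hmass : ∀ (e' s : ℝ), s ∈ Set.Icc (0 : ℝ) δ → ∀ x ∈ D.Ω₁, 0 < D.m2 + D.dm2 e' s x)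
    (hdm2 : ∀ x ∈ D.Ω₁, ContDiff ℝ ∞ (fun p : ℝ × ℝ => D.dm2 p.1 p.2 x))
    (hE1 : ContDiff ℝ ∞ (fun p : ℝ × ℝ => D.E1 p.1 p.2)) (Ak : HiggsLattice.VecField P 0)
    (φ : HiggsLattice.ScalarField P k N) (α β : ℕ) (e₀ : ℝ) :
    iteratedDerivWithin β (fun l' => iteratedDeriv α (fun e' => D.auxE e' l' Ak φ) e₀) (Set.Ici 0) 0
      = iteratedFDerivWithin ℝ (β + α) (fun p : ℝ × ℝ => D.auxE p.1 p.2 Ak φ) (Set.univ ×ˢ Set.Icc 0 δ) (e₀, 0)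
          (Fin.append (fun _ => ((0 : ℝ), (1 : ℝ))) (fun _ => ((1 : ℝ), (0 : ℝ)))) := by
  have hE := contDiffOn_auxE_joint_infty D hmsq ha hL hk1 hk hℓ hrun hm2 hmass hdm2 hE1 Ak φ
  rw [iteratedDerivWithin_Ici_eq_Icc' hδ]
  exact iteratedDerivWithin_iteratedDeriv_slice_eq_append hE (uniqueDiffOn_Icc hδ) (mod_cast le_top) e₀
    ⟨le_rfl, hδ.le⟩

/-- **`D^m_{ℝ×[0,δ]}E_k(e₀, t)` IS A SYMMETRIC `m`-LINEAR MAP** for every `m`, `e₀` and `t ∈ [0, δ]` (the endpoint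
`λ′ = 0` included): Schwarz's theorem within the slab — the mixed partials `∂^{α+β}E_k/∂e′^α∂λ′^β` of (1.5) do
not depend on the order of differentiation (H-joint, `δ > 0`, `C^∞` data). [cite: Balaban1983Higgs3, (1.5) p.412] -/
theorem iteratedFDerivWithin_auxE_comp_perm (hmsq : 0 < D.msq) (ha : 0 < D.a) (hL : 1 < (P.L : ℝ)) (hk1 : 1 ≤ k)
    (hk : k ≤ P.K) (hℓ : D.ell ≠ 0) (hrun : 0 ≤ D.lamRun) (hm2 : 0 < D.m2) {δ : ℝ} (hδ : 0 < δ)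
    (hmass : ∀ (e' s : ℝ), s ∈ Set.Icc (0 : ℝ) δ → ∀ x ∈ D.Ω₁, 0 < D.m2 + D.dm2 e' s x)
    (hdm2 : ∀ x ∈ D.Ω₁, ContDiff ℝ ∞ (fun p : ℝ × ℝ => D.dm2 p.1 p.2 x))
    (hE1 : ContDiff ℝ ∞ (fun p : ℝ × ℝ => D.E1 p.1 p.2)) (Ak : HiggsLattice.VecField P 0)
    (φ : HiggsLattice.ScalarField P k N) (m : ℕ) (e₀ : ℝ) {t : ℝ} (ht : t ∈ Set.Icc (0 : ℝ) δ)
    (v : Fin m → ℝ × ℝ) (σ : Equiv.Perm (Fin m)) :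
    iteratedFDerivWithin ℝ m (fun p : ℝ × ℝ => D.auxE p.1 p.2 Ak φ) (Set.univ ×ˢ Set.Icc 0 δ) (e₀, t) (v ∘ σ)
      = iteratedFDerivWithin ℝ m (fun p : ℝ × ℝ => D.auxE p.1 p.2 Ak φ) (Set.univ ×ˢ Set.Icc 0 δ) (e₀, t) v := by
  have hE := contDiffOn_auxE_joint_infty D hmsq ha hL hk1 hk hℓ hrun hm2 hmass hdm2 hE1 Ak φ
  have hx' : ((e₀, t) : ℝ × ℝ) ∈ closure (interior (Set.univ ×ˢ Set.Icc (0 : ℝ) δ : Set (ℝ × ℝ))) := by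
    rw [interior_prod_eq, interior_univ, closure_prod_eq, closure_univ, interior_Icc, closure_Ioo hδ.ne]
    exact ⟨Set.mem_univ _, ht⟩
  exact iteratedFDerivWithin_comp_perm_of_mem_closure_interior hE (uniqueDiffOn_univ.prod (uniqueDiffOn_Icc hδ))
    (mod_cast le_top) ⟨Set.mem_univ _, ht⟩ hx' v σ

/-- **THE ORDER OF DIFFERENTIATION IN (1.5) IS IMMATERIAL:
`∂^α_{e′}[∂^β_{λ′,+}E_k(e′, ·)(0)](e₀) = ∂^β_{λ′,+}[∂^α_{e′}E_k(·, λ′)(e₀)](0)`** (both one-sided `λ′`-derivatives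
within `[0, ∞)` at `0`; H-joint, `δ > 0`, `C^∞` data; all `α, β, e₀`) — the print's `∂^{α+β}/∂e′^α∂λ′^β` needs no
ordering convention. [cite: Balaban1983Higgs3, (1.5) p.412] -/
theorem iteratedDeriv_iteratedDerivWithin_auxE_comm (hmsq : 0 < D.msq) (ha : 0 < D.a) (hL : 1 < (P.L : ℝ))
    (hk1 : 1 ≤ k) (hk : k ≤ P.K) (hℓ : D.ell ≠ 0) (hrun : 0 ≤ D.lamRun) (hm2 : 0 < D.m2) {δ : ℝ} (hδ : 0 < δ)
    (hmass : ∀ (e' s : ℝ), s ∈ Set.Icc (0 : ℝ) δ → ∀ x ∈ D.Ω₁, 0 < D.m2 + D.dm2 e' s x)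
    (hdm2 : ∀ x ∈ D.Ω₁, ContDiff ℝ ∞ (fun p : ℝ × ℝ => D.dm2 p.1 p.2 x))
    (hE1 : ContDiff ℝ ∞ (fun p : ℝ × ℝ => D.E1 p.1 p.2)) (Ak : HiggsLattice.VecField P 0)
    (φ : HiggsLattice.ScalarField P k N) (α β : ℕ) (e₀ : ℝ) :
    iteratedDeriv α (fun e' => iteratedDerivWithin β (fun l' => D.auxE e' l' Ak φ) (Set.Ici 0) 0) e₀
      = iteratedDerivWithin β (fun l' => iteratedDeriv α (fun e' => D.auxE e' l' Ak φ) e₀) (Set.Ici 0) 0 := by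
  have hE := contDiffOn_auxE_joint_infty D hmsq ha hL hk1 hk hℓ hrun hm2 hmass hdm2 hE1 Ak φ
  have e : (fun e' => iteratedDerivWithin β (fun l' => D.auxE e' l' Ak φ) (Set.Ici 0) 0)
      = fun e' => iteratedDerivWithin β (fun s => (fun p : ℝ × ℝ => D.auxE p.1 p.2 Ak φ) (e', s))
          (Set.Icc 0 δ) 0 := by
    funext e'
    exact iteratedDerivWithin_auxE_Ici_eq_Icc D hδ e' Ak φ β
  rw [e, iteratedDerivWithin_Ici_eq_Icc' hδ]
  exact iteratedDeriv_iteratedDerivWithin_comm hE (uniqueDiffOn_Icc hδ) (mod_cast le_top) e₀ ⟨le_rfl, hδ.le⟩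
    (zero_mem_closure_interior_Icc hδ)

/-- **THE REPAIRED (1.5) IS THE DOUBLE TAYLOR SUM OF THE JOINTLY SMOOTH `E_k` AT `(e′, λ′) = (0, 0⁺)`**:
`𝒫^{(k)} = interaction15R = Σ_{1≤α+β≤n̄} (α!β!)⁻¹ · D^{α+β}_{ℝ×[0,δ]}E_k(0, 0)((1,0)^α, (0,1)^β)` — every term of the
printed `Σ (1/α!β!) ∂^{α+β}E_k/∂e′^α∂λ′^β |_{e′=λ′=0}` is a genuine joint derivative of the typed `E_k` (H-joint,
`δ > 0`, `C^∞` data; every `n̄`). [cite: Balaban1983Higgs3, (1.5) p.412] -/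
theorem interaction15R_eq_sum_iteratedFDerivWithin (hmsq : 0 < D.msq) (ha : 0 < D.a) (hL : 1 < (P.L : ℝ))
    (hk1 : 1 ≤ k) (hk : k ≤ P.K) (hℓ : D.ell ≠ 0) (hrun : 0 ≤ D.lamRun) (hm2 : 0 < D.m2) {δ : ℝ} (hδ : 0 < δ)
    (hmass : ∀ (e' s : ℝ), s ∈ Set.Icc (0 : ℝ) δ → ∀ x ∈ D.Ω₁, 0 < D.m2 + D.dm2 e' s x)
    (hdm2 : ∀ x ∈ D.Ω₁, ContDiff ℝ ∞ (fun p : ℝ × ℝ => D.dm2 p.1 p.2 x))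
    (hE1 : ContDiff ℝ ∞ (fun p : ℝ × ℝ => D.E1 p.1 p.2)) (Ak : HiggsLattice.VecField P 0)
    (φ : HiggsLattice.ScalarField P k N) (nbar : ℕ) :
    interaction15R D nbar Ak φ
      = ∑ ab ∈ B3Sect1Counterterms.idx15 nbar,
          1 / ((ab.1.factorial : ℝ) * (ab.2.factorial : ℝ)) *
            iteratedFDerivWithin ℝ (ab.1 + ab.2) (fun p : ℝ × ℝ => D.auxE p.1 p.2 Ak φ)
              (Set.univ ×ˢ Set.Icc 0 δ) (0, 0)
              (Fin.append (fun _ => ((1 : ℝ), (0 : ℝ))) (fun _ => ((0 : ℝ), (1 : ℝ)))) := by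
  rw [interaction15R]
  refine Finset.sum_congr rfl fun ab _ => ?_
  rw [iteratedDeriv_slice_auxE_eq_iteratedFDerivWithin D hmsq ha hL hk1 hk hℓ hrun hm2 hδ hmass hdm2 hE1 Ak φ
    ab.1 ab.2 0]

end

end Literature.MathematicalPhysics.QuantumFieldTheory.Balaban1983to89.B3Eq15MixedPartials
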